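import Summits.HodgeConjecture.HodgeConjecture.Theses.GenericDivisibility
import Summits.HodgeConjecture.HodgeConjecture.Theorems.GenericDivisibilityHodgeClassesGenericallyDivisible
import Summits.HodgeConjecture.HodgeConjecture.Theorems.GenericDivisibilityHodgeClassesGenericallyDivisibleStubBockstein
import Summits.HodgeConjecture.HodgeConjecture.Theorems.GenericDivisibilityHodgeClassesGenericallyDivisibleStubCoprimeAssembly
import Summits.HodgeConjecture.HodgeConjecture.Theorems.GenericDivisibilityHodgeClassesGenericallyDivisibleStubOnePrimePrinciple
import Summits.HodgeConjecture.HodgeConjecture.Theorems.GenericDivisibilityHodgeClassesGenericallyDivisibleStubMultipleSupportedComplexSupported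
import Summits.HodgeConjecture.HodgeConjecture.Theorems.GenericDivisibilityHodgeClassesGenericallyDivisibleStubModularConiveauOfDivisible
import Summits.HodgeConjecture.HodgeConjecture.Theorems.GenericDivisibilityHodgeClassesGenericallyDivisibleStubInheritAlongMorphism
import Literature.AlgebraicGeometry.Motives.UnramifiedCohomology
import Literature.AlgebraicTopology.SingularHomology.IntegralClassRingChange
import Mathlib.Data.Nat.Factorization.Induction
import HarnessLib

/-!
# Line `Sketch` — crux `GenericDivisibility.HodgeClassesGenericallyDivisible` (C1, stmt-HodgeConjecture-18466)

LEAD-OWNED SKELETON, final revision of cycle 1 (eight of nine registered stubs LANDED; six in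
`Theorems/GenericDivisibilityHodgeClassesGenericallyDivisibleStub*.lean` — `stub_bockstein` p144871,
`stub_coprimeAssembly` p145590, `stub_onePrimePrinciple` p145593,
`stub_multipleSupportedComplexSupported` p145252, `stub_modularConiveau_of_divisible` p145583,
`stub_inheritAlongMorphism` p145798 — and are imported here BY NAME).

The line (`Sketch`, crux-ideate r1 k1: first-lemma sheet of the cards `phantom-calculus`,
`ordinary-inertia-rigidity`, `special-fibre-transfer`) shares ONE reduction of the crux to finite
coefficients, kernel-checked below:

  C1 (for every `m ≥ 1`, `z|_{(X∖Z)(ℂ)} = m • y` on some non-empty Zariski open)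
    ⟸ `stub_bockstein` (LANDED)  — `ker (Hⁿ(E; ℤ) → Hⁿ(E; ℤ/m)) = m · Hⁿ(E; ℤ)` on any space;
     + `stub_coprimeAssembly` (LANDED) — divisible by coprime `a`, `b` on non-empty opens ⇒ by `ab`;
     + `stub_primePowerModularConiveau` — THE ONE OPEN STUB: the mod-`ℓʳ` reduction of an integral
       middle-degree Hodge class has coniveau `≥ 1`, `z mod ℓʳ ∈ N¹ H²ᵖ(X(ℂ); ℤ/ℓʳ)`.
  By the LANDED `stub_cruxIffPrimePowerModularConiveau` (p147609, SketchReduction.lean) the open stub is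
  EQUIVALENT to C1 (nothing weaker than the crux closes it), i.e. it is the crux itself in the
  finite-coefficient language every card of the line speaks; the strategist's census and the
  disprover's cycle-1 verdict (Cruxes/…/Disproof.lean: NO KILL, target-implied, `1 ≤ p` and the Hodge
  type load-bearing — both kept in the stub) place it at HC-middle strength.

Diagnostics of the line, LANDED: `stub_onePrimeSupported` (p146737) — phantom-free divisibility at all
powers of ONE prime forces the complexification into `N¹ H(X(ℂ); ℂ) = supportedClasses X _ 1`
(rational coniveau one, the input of the route's proved `DivisorInduction`), from
`stub_onePrimePrinciple` + `stub_multipleSupportedComplexSupported`.  Verdict on the line: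
`Lines/Sketch.dead.md` (dead as a proof plan: the open stub is the crux; no existence mechanism).
-/

set_option linter.dupNamespace false

noncomputable section

namespace Summit.HodgeConjecture.HodgeConjecture.Cruxes.HodgeClassesGenericallyDivisible.Sketch

open CategoryTheory AlgebraicGeometry
open Literature.AlgebraicGeometry.Motives Literature.AlgebraicGeometry.HodgeTheory
  Literature.AlgebraicTopology.SingularHomology
open Summit.HodgeConjecture.HodgeConjecture.Theses.GenericDivisibility
open Summit.HodgeConjecture.HodgeConjecture.Theorems

universe u v

/-! ### The one open registered stub -/

/-- **THE HARD STUB (crux-strength): prime-power modular coniveau one of Hodge classes.**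
For `p ≥ 1`, `X` smooth projective of dimension `2p` over `ℂ`, an integral class
`z ∈ H²ᵖ(X(ℂ); ℤ)` with complexification of Hodge type `(p, p)`, a prime `ℓ` and `r ≥ 1`: the
reduction `z mod ℓʳ ∈ H²ᵖ(X(ℂ); ℤ/ℓʳ)` lies in `N¹ H²ᵖ(X(ℂ); ℤ/ℓʳ)` (it dies on the complex points of
a non-empty Zariski open). Equivalent to C1 (`stub_primePowerModularConiveau_iff_crux`); HC-middle
strength (STRATEGY-CENSUS §Decomposition D1/D3; Disproof.lean cycle 1).
[cite: ColliotTheleneVoisin2012, §3] [cite: BlochOgus1974ENS, (3.8)] -/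
theorem stub_primePowerModularConiveau : ∀ ⦃p : ℕ⦄ ⦃X : SchemeOver ℂ⦄, 1 ≤ p →
    IsSmoothProjective (2 * p) X →
    ∀ z : singularCohomology ℤ ℤ (ComplexPoints X) (2 * p),
      IsOfHodgeType (2 * p) X (2 * p) p p
        (singularCohomology.ringChange (Int.castRingHom ℂ) (ComplexPoints X) (2 * p) z) →
      ∀ (ℓ r : ℕ), ℓ.Prime → 1 ≤ r →
        singularCohomology.ringChange (Int.castRingHom (ZMod (ℓ ^ r))) (ComplexPoints X) (2 * p) z ∈
          coniveauFiltration (ZMod (ℓ ^ r)) X (2 * p) 1 := by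
  sorry

/-! ### Glue (proved) -/

/-- From modular coniveau one at `m ≥ 1` to divisibility by `m` on a non-empty Zariski open:
unfold `N¹` to "dies off a proper closed `Z`" (`mem_coniveauFiltration_iff_exists`, irreducibility),
move the reduction modulo `m` past the restriction (`genericDivisibility_restrictToCompl_ringChange_zmod`),
and apply the LANDED Bockstein exactness `stub_bockstein` on `(X ∖ Z)(ℂ)`. [cite: BlochOgus1974ENS, (3.8)] -/
theorem divisibleOnOpen_of_modularConiveau {X : SchemeOver ℂ} [IrreducibleSpace X.left] {q m : ℕ}
    (hm : 1 ≤ m) (z : singularCohomology ℤ ℤ (ComplexPoints X) q)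
    (hz : singularCohomology.ringChange (Int.castRingHom (ZMod m)) (ComplexPoints X) q z ∈
      coniveauFiltration (ZMod m) X q 1) :
    ∃ Z : Set X.left, IsClosed Z ∧ Z ≠ Set.univ ∧
      ∃ y : singularCohomology ℤ ℤ (complexPointsCompl X Z) q, m • y = restrictToCompl ℤ X q Z z := by
  obtain ⟨Z, hZ, hr1, h0⟩ := (mem_coniveauFiltration_iff_exists (ZMod m) q).1 hz
  refine ⟨Z, hZ, (forall_one_le_coheight_iff_ne_univ hZ).1 hr1, ?_⟩
  have h1 : singularCohomology.ringChange (Int.castRingHom (ZMod m)) (complexPointsCompl X Z) q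
      (restrictToCompl ℤ X q Z z) = 0 := by
    rw [← genericDivisibility_restrictToCompl_ringChange_zmod]
    exact h0
  obtain ⟨y, hy⟩ := stub_bockstein q m hm _ h1
  exact ⟨y, hy.symm⟩

/-- The prime-power case of C1 from the hard stub. [cite: BlochOgus1974ENS, (3.8)] -/
theorem divisibleOnOpen_primePow {p : ℕ} {X : SchemeOver ℂ} (hp : 1 ≤ p)
    (hX : IsSmoothProjective (2 * p) X) (z : singularCohomology ℤ ℤ (ComplexPoints X) (2 * p))
    (hz : IsOfHodgeType (2 * p) X (2 * p) p p
      (singularCohomology.ringChange (Int.castRingHom ℂ) (ComplexPoints X) (2 * p) z))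
    {ℓ r : ℕ} (hℓ : ℓ.Prime) (hr : 1 ≤ r) :
    ∃ Z : Set X.left, IsClosed Z ∧ Z ≠ Set.univ ∧
      ∃ y : singularCohomology ℤ ℤ (complexPointsCompl X Z) (2 * p),
        (ℓ ^ r) • y = restrictToCompl ℤ X (2 * p) Z z := by
  haveI := hX.geometricallyIrreducible
  haveI : IrreducibleSpace X.left :=
    AlgebraicGeometry.GeometricallyIrreducible.irreducibleSpace_of_subsingleton X.hom
  exact divisibleOnOpen_of_modularConiveau (Nat.one_le_pow r ℓ hℓ.pos) z
    (stub_primePowerModularConiveau hp hX z hz ℓ r hℓ hr)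

/-! ### The composition: the crux BY NAME from the stubs -/

/-- **The crux from the stubs** (no `sorry` outside `stub_*`): for `m ≥ 1`, induct on `m` along
its factorisation into prime powers (`Nat.recOnPosPrimePosCoprime`): `m = 1` is `y = z|` on
`X ∖ ∅`; a prime power is `divisibleOnOpen_primePow` (hard stub + LANDED Bockstein); coprime factors
are glued by the LANDED `stub_coprimeAssembly` (irreducibility of `X`). [cite: BlochOgus1974ENS, (3.8)] -/
theorem HodgeClassesGenericallyDivisible_of : HodgeClassesGenericallyDivisible := by
  unfold Summit.HodgeConjecture.HodgeConjecture.Theses.GenericDivisibility.HodgeClassesGenericallyDivisible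
  intro p X hp hX z hz m hm
  haveI := hX.geometricallyIrreducible
  haveI : IrreducibleSpace X.left :=
    AlgebraicGeometry.GeometricallyIrreducible.irreducibleSpace_of_subsingleton X.hom
  change ∃ Z : Set X.left, IsClosed Z ∧ Z ≠ Set.univ ∧
    ∃ y : singularCohomology ℤ ℤ (complexPointsCompl X Z) (2 * p), m • y = restrictToCompl ℤ X (2 * p) Z z
  revert hm
  induction m using Nat.recOnPosPrimePosCoprime with
  | prime_pow ℓ r hℓ hr =>
    intro _
    exact divisibleOnOpen_primePow hp hX z hz hℓ hr
  | zero => intro h; exact absurd h (by omega)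
  | one =>
    intro _
    exact ⟨∅, isClosed_empty, fun h ↦ (Set.empty_ne_univ h).elim, restrictToCompl ℤ X (2 * p) ∅ z,
      one_smul ℕ _⟩
  | coprime a b ha hb hab iha ihb =>
    intro _
    exact stub_coprimeAssembly (2 * p) z a b hab (iha (by omega)) (ihb (by omega))

/-- The crux, by name. -/
theorem HodgeClassesGenericallyDivisible_holds : HodgeClassesGenericallyDivisible :=
  HodgeClassesGenericallyDivisible_of

/-! ### Landed elsewhere (not restated here)

* `stub_cruxIffPrimePowerModularConiveau` (p147609, `Theorems/…SketchReduction.lean`): the open stub above is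
  EQUIVALENT to the crux — `hodgeClassesGenericallyDivisible_of_primePowerModularConiveau` (this file's
  composition with the stub as hypothesis) and `primePowerModularConiveau_of_hodgeClassesGenericallyDivisible`
  (C1 at `m = ℓʳ` + `stub_modularConiveau_of_divisible`).
* `stub_onePrimeSupported` (p146737, `Theorems/…StubOnePrimeSupported.lean`): one-prime principle ⇒ rational
  coniveau one (`stub_onePrimePrinciple` + `stub_multipleSupportedComplexSupported`).
-/

end Summit.HodgeConjecture.HodgeConjecture.Cruxes.HodgeClassesGenericallyDivisible.Sketch

end
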